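import Summits.CriticalPhenomena.PercolationContinuityZ3.Theorems.PercNearOneGluingNoHeavyLowerTailAntitheticOneSidedCubes
import HarnessLib

/-!
# `NoHeavyLowerTail` (stmt-CriticalPhenomena-4575) — antithetic cluster pairs: the abstract LIFT-COMPOSITION lemma (⊕-positivity survives
# averaging over a red-dominated cube of LIFT MAPS; prim-hp-2 gen 64, HOME/MEMO-gen64.md §1)

Support file (`--supports stmt-CriticalPhenomena-4575`, hull-port prover `prim-hp-2`, gen 64).  No definitions, no named facts, no sorries;
standard axioms.  Purely abstract (finite sums); the graph instance is the 1-SUM LEMMA of …AntitheticOneSum.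

Notation of …AntitheticOneSidedCubes: `K : Set V → Set V → ℝ` is TWISTED-MONOTONE if it grows when the first argument grows and the second
shrinks, SUPER-ODD if `K P Q + K Q P ≥ 0`; a finite family of pairs `(P₁ j, Q₁ j)` is ⊕-POSITIVE if `Σ_j K₁K₂(P₁ j, Q₁ j) ≥ 0` for all
twisted-monotone super-odd `K₁, K₂`.

* `Antithetic.lift_composition_sum_nonneg` — LIFT MAPS `Φ T, Ψ T : Set V → Set V` indexed by the cube `Set ι`, each monotone in the set,
  `Φ` monotone / `Ψ` antitone in `T`, with ANTIPODAL DOMINATION `Ψ Tᶜ P ⊆ Φ T P`.  If `(P₁, Q₁)` is ⊕-positive then so is the lifted double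
  family: `Σ_j Σ_T K₁K₂(Φ T (P₁ j), Ψ T (Q₁ j)) ≥ 0` for all twisted-monotone SUPER-ODD `K₁, K₂`.  Proof: Harris' inequality in `T` for each
  `j` bounds the inner sum below by `K̃₁K̃₂(P₁ j, Q₁ j)/|Set ι|` with the cube-averaged `K̃ᵢ(P,Q) = Σ_T Kᵢ(Φ T P, Ψ T Q)`, which is
  twisted-monotone and — pairing `T` with `Tᶜ` and using domination twice — super-odd.
  This generalises `Antithetic.oplus_composition_sum_nonneg` (gen 56: `Φ T P = P ∪ Wr T ∪ A`, `Ψ T Q = Q ∪ Wb T`, odd `h`) to arbitrary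
  lifts and super-odd test functions; the new instance is the CONDITIONAL lift `Φ T P = P ∪ {u | a ∈ P ∧ u ∈ Wr T}` of a graph hung at a
  vertex `a` (…AntitheticOneSum).
* `Antithetic.lift_composition_filter_nonneg` — the same with side 1 given as a `Finset.filter` of a `Fintype` (the shape of the
  colouring sums).
[cite: VandenbergHaggstromKahn2005, §1 p. 6 ("Harris' inequality")]
-/

noncomputable section

namespace Summit.CriticalPhenomena.PercolationContinuityZ3.Theorems

open scoped Classical

namespace Antithetic

variable {V : Type*} {ι : Type*} [Fintype ι]

/-- **Lift composition.**  Side 1: a ⊕-positive finite family of pairs `(P₁ j, Q₁ j)`.  Side 2: lift maps `Φ T, Ψ T` (`T : Set ι`), monotone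
in the set argument, `Φ` monotone and `Ψ` antitone in `T`, with antipodal domination `Ψ Tᶜ P ⊆ Φ T P`.  Then for all twisted-monotone
super-odd `K₁, K₂`: `0 ≤ Σ_j Σ_T K₁ (Φ T (P₁ j)) (Ψ T (Q₁ j)) * K₂ (Φ T (P₁ j)) (Ψ T (Q₁ j))`. [this work] -/
theorem lift_composition_sum_nonneg {J : Type*} [Fintype J] (P₁ Q₁ : J → Set V)
    (hplus : ∀ K₁ K₂ : Set V → Set V → ℝ,
      (∀ ⦃P P' Q Q' : Set V⦄, P ⊆ P' → Q' ⊆ Q → K₁ P Q ≤ K₁ P' Q') → (∀ P Q, 0 ≤ K₁ P Q + K₁ Q P) →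
      (∀ ⦃P P' Q Q' : Set V⦄, P ⊆ P' → Q' ⊆ Q → K₂ P Q ≤ K₂ P' Q') → (∀ P Q, 0 ≤ K₂ P Q + K₂ Q P) →
      0 ≤ ∑ j, K₁ (P₁ j) (Q₁ j) * K₂ (P₁ j) (Q₁ j))
    (Φ Ψ : Set ι → Set V → Set V) (hΦP : ∀ T, Monotone (Φ T)) (hΨP : ∀ T, Monotone (Ψ T))
    (hΦT : ∀ P, Monotone (fun T => Φ T P)) (hΨT : ∀ Q, Antitone (fun T => Ψ T Q)) (hdom : ∀ T P, Ψ Tᶜ P ⊆ Φ T P)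
    {K₁ K₂ : Set V → Set V → ℝ}
    (hK₁ : ∀ ⦃P P' Q Q' : Set V⦄, P ⊆ P' → Q' ⊆ Q → K₁ P Q ≤ K₁ P' Q') (hso₁ : ∀ P Q, 0 ≤ K₁ P Q + K₁ Q P)
    (hK₂ : ∀ ⦃P P' Q Q' : Set V⦄, P ⊆ P' → Q' ⊆ Q → K₂ P Q ≤ K₂ P' Q') (hso₂ : ∀ P Q, 0 ≤ K₂ P Q + K₂ Q P) :
    0 ≤ ∑ j, ∑ T : Set ι, K₁ (Φ T (P₁ j)) (Ψ T (Q₁ j)) * K₂ (Φ T (P₁ j)) (Ψ T (Q₁ j)) := by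
  -- the cube-averaged test functions
  let L₁ : Set V → Set V → ℝ := fun P Q => ∑ T : Set ι, K₁ (Φ T P) (Ψ T Q)
  let L₂ : Set V → Set V → ℝ := fun P Q => ∑ T : Set ι, K₂ (Φ T P) (Ψ T Q)
  have hsumc : ∀ (c : Set ι → ℝ), ∑ T : Set ι, c Tᶜ = ∑ T : Set ι, c T := fun c =>
    Fintype.sum_equiv (Equiv.mk compl compl compl_compl compl_compl) _ _ fun T => rfl
  -- they are twisted-monotone …
  have hLmono : ∀ {K : Set V → Set V → ℝ}, (∀ ⦃P P' Q Q' : Set V⦄, P ⊆ P' → Q' ⊆ Q → K P Q ≤ K P' Q') →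
      ∀ ⦃P P' Q Q' : Set V⦄, P ⊆ P' → Q' ⊆ Q →
        (∑ T : Set ι, K (Φ T P) (Ψ T Q)) ≤ ∑ T : Set ι, K (Φ T P') (Ψ T Q') := by
    intro K hK P P' Q Q' hP hQ
    exact Finset.sum_le_sum fun T _ => hK (hΦP T hP) (hΨP T hQ)
  -- … and super-odd: pair `T` with `Tᶜ`, domination twice, then super-oddness of `K`
  have hLso : ∀ {K : Set V → Set V → ℝ}, (∀ ⦃P P' Q Q' : Set V⦄, P ⊆ P' → Q' ⊆ Q → K P Q ≤ K P' Q') →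
      (∀ P Q, 0 ≤ K P Q + K Q P) →
      ∀ P Q, 0 ≤ (∑ T : Set ι, K (Φ T P) (Ψ T Q)) + ∑ T : Set ι, K (Φ T Q) (Ψ T P) := by
    intro K hK hso P Q
    rw [← hsumc (fun T => K (Φ T Q) (Ψ T P)), ← Finset.sum_add_distrib]
    refine Finset.sum_nonneg fun T _ => ?_
    have h1 : Ψ T Q ⊆ Φ Tᶜ Q := by have := hdom Tᶜ Q; rwa [compl_compl] at this
    have h2 : K (Ψ T Q) (Φ T P) ≤ K (Φ Tᶜ Q) (Ψ Tᶜ P) := hK h1 (hdom T P)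
    have h3 := hso (Φ T P) (Ψ T Q)
    show 0 ≤ K (Φ T P) (Ψ T Q) + K (Φ Tᶜ Q) (Ψ Tᶜ P)
    linarith
  have hpos := hplus L₁ L₂ (hLmono hK₁) (hLso hK₁ hso₁) (hLmono hK₂) (hLso hK₂ hso₂)
  -- Harris in `T` for each `j`
  have hN : (0 : ℝ) < (Fintype.card (Set ι) : ℝ) := by exact_mod_cast Fintype.card_pos
  have hj : ∀ j, L₁ (P₁ j) (Q₁ j) * L₂ (P₁ j) (Q₁ j) ≤ (Fintype.card (Set ι) : ℝ) *
      ∑ T : Set ι, K₁ (Φ T (P₁ j)) (Ψ T (Q₁ j)) * K₂ (Φ T (P₁ j)) (Ψ T (Q₁ j)) := by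
    intro j
    refine harris_uniform_cov (a := fun T => K₁ (Φ T (P₁ j)) (Ψ T (Q₁ j))) (b := fun T => K₂ (Φ T (P₁ j)) (Ψ T (Q₁ j))) ?_ ?_
    · exact fun T T' hTT' => hK₁ (hΦT (P₁ j) hTT') (hΨT (Q₁ j) hTT')
    · exact fun T T' hTT' => hK₂ (hΦT (P₁ j) hTT') (hΨT (Q₁ j) hTT')
  have hsum : ∑ j, L₁ (P₁ j) (Q₁ j) * L₂ (P₁ j) (Q₁ j) ≤ (Fintype.card (Set ι) : ℝ) *
      ∑ j, ∑ T : Set ι, K₁ (Φ T (P₁ j)) (Ψ T (Q₁ j)) * K₂ (Φ T (P₁ j)) (Ψ T (Q₁ j)) := by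
    rw [Finset.mul_sum]
    exact Finset.sum_le_sum fun j _ => hj j
  exact (mul_nonneg_iff_of_pos_left hN).1 (le_trans hpos hsum)

/-- **Lift composition, `Finset.filter` form of side 1.**  As `lift_composition_sum_nonneg`, with side 1 the sub-family `{j | p j}` of a
finite type (the shape `Σ_{ω : pred ω}` of the colouring sums). [this work] -/
theorem lift_composition_filter_nonneg {J : Type*} [Fintype J] (p : J → Prop) [DecidablePred p] (P₁ Q₁ : J → Set V)
    (hplus : ∀ K₁ K₂ : Set V → Set V → ℝ,
      (∀ ⦃P P' Q Q' : Set V⦄, P ⊆ P' → Q' ⊆ Q → K₁ P Q ≤ K₁ P' Q') → (∀ P Q, 0 ≤ K₁ P Q + K₁ Q P) →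
      (∀ ⦃P P' Q Q' : Set V⦄, P ⊆ P' → Q' ⊆ Q → K₂ P Q ≤ K₂ P' Q') → (∀ P Q, 0 ≤ K₂ P Q + K₂ Q P) →
      0 ≤ ∑ j ∈ Finset.univ.filter (fun j => p j), K₁ (P₁ j) (Q₁ j) * K₂ (P₁ j) (Q₁ j))
    (Φ Ψ : Set ι → Set V → Set V) (hΦP : ∀ T, Monotone (Φ T)) (hΨP : ∀ T, Monotone (Ψ T))
    (hΦT : ∀ P, Monotone (fun T => Φ T P)) (hΨT : ∀ Q, Antitone (fun T => Ψ T Q)) (hdom : ∀ T P, Ψ Tᶜ P ⊆ Φ T P)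
    {K₁ K₂ : Set V → Set V → ℝ}
    (hK₁ : ∀ ⦃P P' Q Q' : Set V⦄, P ⊆ P' → Q' ⊆ Q → K₁ P Q ≤ K₁ P' Q') (hso₁ : ∀ P Q, 0 ≤ K₁ P Q + K₁ Q P)
    (hK₂ : ∀ ⦃P P' Q Q' : Set V⦄, P ⊆ P' → Q' ⊆ Q → K₂ P Q ≤ K₂ P' Q') (hso₂ : ∀ P Q, 0 ≤ K₂ P Q + K₂ Q P) :
    0 ≤ ∑ j ∈ Finset.univ.filter (fun j => p j), ∑ T : Set ι,
      K₁ (Φ T (P₁ j)) (Ψ T (Q₁ j)) * K₂ (Φ T (P₁ j)) (Ψ T (Q₁ j)) := by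
  have hsub : ∀ (f : J → ℝ), ∑ j ∈ Finset.univ.filter (fun j => p j), f j = ∑ j : {j : J // p j}, f j.1 :=
    fun f => Finset.sum_subtype _ (fun j => by simp only [Finset.mem_filter, Finset.mem_univ, true_and]) f
  rw [hsub]
  refine lift_composition_sum_nonneg (fun j : {j : J // p j} => P₁ j.1) (fun j => Q₁ j.1) ?_ Φ Ψ hΦP hΨP hΦT hΨT hdom
    hK₁ hso₁ hK₂ hso₂
  intro L₁ L₂ hL₁ hsoL₁ hL₂ hsoL₂
  have h := hplus L₁ L₂ hL₁ hsoL₁ hL₂ hsoL₂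
  rw [hsub (fun j => L₁ (P₁ j) (Q₁ j) * L₂ (P₁ j) (Q₁ j))] at h
  exact h

end Antithetic

end Summit.CriticalPhenomena.PercolationContinuityZ3.Theorems
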